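import Summits.QuantumFields.YangMills.Theorems.VirialFluxGapCombTreePoincare
import Summits.QuantumFields.YangMills.Theorems.VirialFluxGapAnchorSliceRotations
import Summits.QuantumFields.YangMills.Theorems.LuscherReductionTwistedTraceScalingLatticeHS
import HarnessLib

/-!
# The ANGLE between the anchor slice and the gauge modes: `Σ‖a‖² + Σ‖b‖² ≤ C_L · ‖(a, b) + G_R η‖²` for chart coordinates `(a, b)` in the
# anchor slice and ANY imaginary gauge mode `η` — the slice-dependent half of the coercivity input (item (a)) of the DIRECT Laplace road to
# ⟨stmt-QuantumFields-24204⟩ `VirialFluxGap.SharpTwistedLaplace`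

Helper module (free-hands work of width seat ym-line-sfw-p2-w2 g50, cell ym-idea-1; `--supports 24204`), quaternion letters.  A ring history near the
reference ring `R_s` is read in the LEFT charts `u = e^{a}·r` (links, every slice) and `e^{b}·g` (seam sites); the linearised gauge mode of
`η : sites → Im ℍ` is `G_R η = (η(x) − r_e η(x + ê_k) r_e* ; η(x) − g_x η(x) g_x*)` (✓`exists_skew_linearised_le_sqrt_ringDeficit`, Cor B, in `su2Quat`
letters).  The ANCHOR SLICE (w3 g57, ✓`VirialFluxGapAnchorChartDefs`) is: tree gauge on slice `i₀` (`a i₀ e = 0`, `r_e = 1` on the comb tree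
✓`treeEdge`), seam anchor `b(0) ∈ ℝ·n_C` (`g 0 = n_C`), link anchor `a i₀ e₀ ⊥ n_C` (`r_{e₀} = ±n_N`, `n_N ⊥ n_C` pure units).
* §1 `norm_comm_sq_pure` (`‖x n − n x‖² = 4(‖x‖² − ⟪x,n⟫²)`), `anchor_transversality` (★ `4‖x‖² ≤ ‖b₀ + (x − n_C x n_C*)‖² + ‖a₀ + (x − n_N x n_N*)‖²`
  for `b₀ ∈ ℝ n_C`, `a₀ ⊥ n_C`, `x` imaginary);
* §2 bookkeeping of the edge sums (`Σ_e f(∂⁻e) = 3Σ_x f x = Σ_e f(∂⁺e)`), elementary inequalities;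
* §3 ★★ `anchorSlice_angle` — for every imaginary `η`:
  `Σ_i Σ_e ‖a i e‖² + Σ_x ‖b x‖² ≤ 2400·|slices|²·L⁷ · (Σ_i Σ_e ‖a i e + (η(∂⁻e) − r_e η(∂⁺e) r_e*)‖² + Σ_x ‖b x + (η x − g_x η x g_x*)‖²)`
  (split `η = η(0) + η̃`; the tree links of slice `i₀` see `η̃` through ✓`CombTree.comb_poincare`; the two anchors see the constant `η(0)` through §1).
Everything here is PROVED; no definitions, no named facts (namespace `Summit.QuantumFields.YangMills.Theorems.VirialFluxGap.AnchorSlice`).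

HONEST FRAMING: finite-dimensional linear algebra; ⟨24204⟩, ⟨24319⟩, ⟨22884⟩ and every rung stay OPEN; the Yang–Mills mass gap (Clay) is NOT touched; no
summit is proved by a line.

## References
* M. Lüscher, Nucl. Phys. B219 (1983), §2 (rigidity of twist-eating configurations). [Luscher1983]
* E. Seiler, LNP 159 (1982), §2 (tree gauges). [SeilerLNP1982]
-/

set_option autoImplicit false

noncomputable section

open scoped Quaternion RealInnerProductSpace BigOperators
open Finset
open Literature.MathematicalPhysics.QuantumFieldTheory hiding SU2
open Literature.MathematicalPhysics.QuantumLattice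
open Summit.QuantumFields.YangMills.Theorems.FemtoTransferGap
open Summit.QuantumFields.YangMills.Theorems.QuantitativeLaplace (quat_inner_conj_left)
open Summit.QuantumFields.BalabanUV.InfraRed.StrongCouplingSphereCalculus (mul_self_of_re_eq_zero)
open Summit.QuantumFields.YangMills.Theorems.FibreLocalInverse (star_mul_self_of_norm_eq_one self_mul_star_of_norm_eq_one)

namespace Summit.QuantumFields.YangMills.Theorems.VirialFluxGap.AnchorSlice

/-! ## §1 Transversality of the anchor slice to the constant gauge modes -/

/-- For imaginary `x` and a pure unit `n`: `‖x n − n x‖² = 4(‖x‖² − ⟪x, n⟫²)` (Lagrange's identity for `2 x × n`). [folklore] -/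
theorem norm_comm_sq_pure {x n : ℍ} (hx : x.re = 0) (hn0 : n.re = 0) (hn1 : ‖n‖ = 1) :
    ‖x * n - n * x‖ ^ 2 = 4 * (‖x‖ ^ 2 - ⟪x, n⟫ ^ 2) := by
  have hns : n.imI ^ 2 + n.imJ ^ 2 + n.imK ^ 2 = 1 := by
    have := sq_norm_eq_sum_sq n; rw [hn1, hn0] at this; nlinarith [this]
  have hin : ⟪x, n⟫ = x.imI * n.imI + x.imJ * n.imJ + x.imK * n.imK := by
    rw [Quaternion.inner_def]; simp [hx, hn0]
  rw [sq_norm_eq_sum_sq, sq_norm_eq_sum_sq, hin]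
  simp only [Quaternion.re_sub, Quaternion.re_mul, Quaternion.imI_sub, Quaternion.imI_mul, Quaternion.imJ_sub, Quaternion.imJ_mul,
    Quaternion.imK_sub, Quaternion.imK_mul, hx, hn0]
  linear_combination (4 * (x.imI ^ 2 + x.imJ ^ 2 + x.imK ^ 2)) * hns

/-- `(x − n x n*) n = x n − n x` for a unit `n`. [folklore] -/
theorem sub_conj_mul_unit {x n : ℍ} (hn1 : ‖n‖ = 1) : (x - n * x * star n) * n = x * n - n * x := by
  rw [sub_mul, mul_assoc, star_mul_self_of_norm_eq_one hn1, mul_one]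

/-- ★ **Anchor transversality.**  `n_C ⊥ n_N` pure units, `x` imaginary, `b₀ = t·n_C`, `a₀ ⊥ n_C`:
`4‖x‖² ≤ ‖t·n_C + (x − n_C x n_C*)‖² + ‖a₀ + (x − n_N x n_N*)‖²`. [cite: Luscher1983, §2] -/
theorem anchor_transversality {nC nN x a₀ : ℍ} (t : ℝ) (hC0 : nC.re = 0) (hC1 : ‖nC‖ = 1) (hN0 : nN.re = 0) (hN1 : ‖nN‖ = 1)
    (hCN : ⟪nC, nN⟫ = 0) (hx : x.re = 0) (ha : ⟪a₀, nC⟫ = 0) :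
    4 * ‖x‖ ^ 2 ≤ ‖t • nC + (x - nC * x * star nC)‖ ^ 2 + ‖a₀ + (x - nN * x * star nN)‖ ^ 2 := by
  have hCC : star nC * nC = 1 := star_mul_self_of_norm_eq_one hC1
  have hNC : nN * nC = -(nC * nN) := mul_eq_neg_mul_of_pure_orth hC0 hN0 hCN
  have hNN : nN * nN = -1 := mul_self_of_re_eq_zero hN0 hN1
  -- the seam term is an orthogonal sum and contains the commutator
  have horth : ⟪t • nC, x - nC * x * star nC⟫ = 0 := by
    have h1 : ⟪nC * x * star nC, nC⟫ = ⟪x, nC⟫ := by rw [quat_inner_conj_left, hCC, one_mul]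
    rw [real_inner_smul_left, inner_sub_right, real_inner_comm (nC * x * star nC) nC, h1, real_inner_comm x nC, sub_self, mul_zero]
  have hseam : ‖t • nC + (x - nC * x * star nC)‖ ^ 2 = ‖t • nC‖ ^ 2 + ‖x * nC - nC * x‖ ^ 2 := by
    rw [@norm_add_sq_real, horth, mul_zero, add_zero, ← sub_conj_mul_unit hC1, norm_mul, hC1, mul_one]
  -- the link term has `n_C`-component `2⟪x, n_C⟫`
  have hX : star nN * nC * nN = -nC := by
    rw [star_eq_neg_of_pure hN0, neg_mul, neg_mul, hNC, neg_mul, neg_neg, mul_assoc, hNN, mul_neg_one]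
  have hcomp : ⟪a₀ + (x - nN * x * star nN), nC⟫ = 2 * ⟪x, nC⟫ := by
    rw [inner_add_left, ha, zero_add, inner_sub_left, quat_inner_conj_left, hX, inner_neg_right]; ring
  have hlink : 4 * ⟪x, nC⟫ ^ 2 ≤ ‖a₀ + (x - nN * x * star nN)‖ ^ 2 := by
    have h := abs_real_inner_le_norm (a₀ + (x - nN * x * star nN)) nC
    rw [hcomp, hC1, mul_one] at h
    have h2 : (2 * ⟪x, nC⟫) ^ 2 ≤ ‖a₀ + (x - nN * x * star nN)‖ ^ 2 := by
      rw [← sq_abs (2 * ⟪x, nC⟫)]; exact pow_le_pow_left₀ (abs_nonneg _) h 2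
    linarith
  rw [hseam, norm_comm_sq_pure hx hC0 hC1]
  nlinarith [sq_nonneg ‖t • nC‖]


/-! ## §2 Bookkeeping of edge sums and elementary inequalities -/

section Bookkeeping

variable {L : ℕ} [NeZero L]

/-- `Σ_e f(∂⁻e) = 3·Σ_x f(x)` on `(ℤ/L)³` (three directions per site). [folklore] -/
theorem sum_edge_fst (f : Site 3 L → ℝ) : ∑ e : Edge 3 L, f e.1 = 3 * ∑ x : Site 3 L, f x := by
  rw [Fintype.sum_prod_type]
  simp only [Finset.sum_const, Finset.card_univ, Fintype.card_fin, nsmul_eq_mul, Nat.cast_ofNat]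
  rw [Finset.mul_sum]

/-- `Σ_e f(∂⁺e) = 3·Σ_x f(x)` on `(ℤ/L)³` (translation invariance of the site sum). [folklore] -/
theorem sum_edge_shift (f : Site 3 L → ℝ) : ∑ e : Edge 3 L, f (e.1.shift e.2) = 3 * ∑ x : Site 3 L, f x := by
  have h : ∀ k : Fin 3, ∑ x : Site 3 L, f (x.shift k) = ∑ x : Site 3 L, f x := fun k =>
    Fintype.sum_equiv (Equiv.addRight (Pi.single k (1 : ZMod L))) _ _ (fun _ => rfl)
  rw [Fintype.sum_prod_type, Finset.sum_comm]
  calc ∑ k : Fin 3, ∑ x : Site 3 L, f (((x, k) : Edge 3 L).1.shift ((x, k) : Edge 3 L).2)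
      = ∑ k : Fin 3, ∑ x : Site 3 L, f x := Finset.sum_congr rfl (fun k _ => h k)
    _ = 3 * ∑ x : Site 3 L, f x := by
        rw [Finset.sum_const, Finset.card_univ, Fintype.card_fin, nsmul_eq_mul, Nat.cast_ofNat]

end Bookkeeping

/-- The constant-mode term is controlled by the full term and the fluctuation: for units `r`,
`‖a + (η̄ − r η̄ r*)‖² ≤ 3(‖a + (η₁ − r η₂ r*)‖² + ‖η₁ − η̄‖² + ‖η₂ − η̄‖²)`. [folklore] -/
theorem const_term_sq_le {r a η₁ η₂ ηbar : ℍ} (hr : ‖r‖ = 1) :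
    ‖a + (ηbar - r * ηbar * star r)‖ ^ 2 ≤ 3 * (‖a + (η₁ - r * η₂ * star r)‖ ^ 2 + ‖η₁ - ηbar‖ ^ 2 + ‖η₂ - ηbar‖ ^ 2) := by
  have e : a + (ηbar - r * ηbar * star r) = (a + (η₁ - r * η₂ * star r)) - (η₁ - ηbar) + r * (η₂ - ηbar) * star r := by noncomm_ring
  have hn : ‖r * (η₂ - ηbar) * star r‖ = ‖η₂ - ηbar‖ := by rw [norm_mul, norm_mul, norm_star, hr, one_mul, mul_one]
  have h1 : ‖a + (ηbar - r * ηbar * star r)‖ ≤ ‖a + (η₁ - r * η₂ * star r)‖ + ‖η₁ - ηbar‖ + ‖η₂ - ηbar‖ := by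
    rw [e]
    calc ‖a + (η₁ - r * η₂ * star r) - (η₁ - ηbar) + r * (η₂ - ηbar) * star r‖
        ≤ ‖a + (η₁ - r * η₂ * star r) - (η₁ - ηbar)‖ + ‖r * (η₂ - ηbar) * star r‖ := norm_add_le _ _
      _ ≤ ‖a + (η₁ - r * η₂ * star r)‖ + ‖η₁ - ηbar‖ + ‖η₂ - ηbar‖ := by rw [hn]; linarith [norm_sub_le (a + (η₁ - r * η₂ * star r)) (η₁ - ηbar)]
  have h0 : 0 ≤ ‖a + (ηbar - r * ηbar * star r)‖ := norm_nonneg _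
  calc ‖a + (ηbar - r * ηbar * star r)‖ ^ 2 ≤ (‖a + (η₁ - r * η₂ * star r)‖ + ‖η₁ - ηbar‖ + ‖η₂ - ηbar‖) ^ 2 :=
        pow_le_pow_left₀ h0 h1 2
    _ ≤ _ := by
        nlinarith [sq_nonneg (‖a + (η₁ - r * η₂ * star r)‖ - ‖η₁ - ηbar‖), sq_nonneg (‖η₁ - ηbar‖ - ‖η₂ - ηbar‖),
          sq_nonneg (‖a + (η₁ - r * η₂ * star r)‖ - ‖η₂ - ηbar‖)]

/-- The chart coordinate is controlled by the constant-mode term: `‖a‖² ≤ 2‖a + (η̄ − rη̄r*)‖² + 8‖η̄‖²` for a unit `r`. [folklore] -/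
theorem coord_sq_le {r a ηbar : ℍ} (hr : ‖r‖ = 1) : ‖a‖ ^ 2 ≤ 2 * ‖a + (ηbar - r * ηbar * star r)‖ ^ 2 + 8 * ‖ηbar‖ ^ 2 := by
  have hn : ‖ηbar - r * ηbar * star r‖ ≤ 2 * ‖ηbar‖ := by
    calc ‖ηbar - r * ηbar * star r‖ ≤ ‖ηbar‖ + ‖r * ηbar * star r‖ := norm_sub_le _ _
      _ = 2 * ‖ηbar‖ := by rw [norm_mul, norm_mul, norm_star, hr, one_mul, mul_one]; ring
  have h1 : ‖a‖ ≤ ‖a + (ηbar - r * ηbar * star r)‖ + 2 * ‖ηbar‖ := by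
    have := norm_sub_le (a + (ηbar - r * ηbar * star r)) (ηbar - r * ηbar * star r)
    rw [add_sub_cancel_right] at this; linarith
  have h2 := pow_le_pow_left₀ (norm_nonneg a) h1 2
  nlinarith [sq_nonneg (‖a + (ηbar - r * ηbar * star r)‖ - 2 * ‖ηbar‖)]


/-! ## §3 The angle lemma -/

/-- The arithmetic of the constants in the angle lemma. [folklore] -/
theorem angle_constants {m L Sl Ss P T Dl Ds A nb : ℝ} (hm1 : 1 ≤ m) (hL1 : 1 ≤ L) (hSl : 0 ≤ Sl) (hSs : 0 ≤ Ss) (hnb : 0 ≤ nb)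
    (hT : T ≤ Sl) (hPT : P ≤ 9 * L ^ 4 * T) (hDl : Dl ≤ 3 * Sl + 18 * m * P) (hDs : Ds ≤ 3 * Ss + 6 * P) (hanch : 4 * nb ≤ Dl + Ds)
    (hA : A ≤ 2 * (Dl + Ds) + 8 * nb * ((3 * m + 1) * L ^ 3)) :
    A ≤ 2400 * m ^ 2 * L ^ 7 * (Sl + Ss) := by
  have hL0 : 0 ≤ L := by linarith
  have hL3 : 1 ≤ L ^ 3 := one_le_pow₀ hL1
  have hL4 : 1 ≤ L ^ 4 := one_le_pow₀ hL1
  have hS0 : 0 ≤ Sl + Ss := by linarith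
  have hP' : P ≤ 9 * L ^ 4 * (Sl + Ss) := hPT.trans (by nlinarith)
  have hD : Dl + Ds ≤ (3 + (162 * m + 54) * L ^ 4) * (Sl + Ss) := by nlinarith
  have hD0 : 0 ≤ Dl + Ds := by linarith
  have hN : (3 * m + 1) * L ^ 3 ≤ 4 * m * L ^ 3 := by nlinarith
  have h1 : A ≤ (2 + 8 * m * L ^ 3) * (Dl + Ds) := by nlinarith
  have h2 : 2 + 8 * m * L ^ 3 ≤ 10 * m * L ^ 3 := by nlinarith
  have h3 : 3 + (162 * m + 54) * L ^ 4 ≤ 219 * m * L ^ 4 := by nlinarith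
  have h4 : (2 + 8 * m * L ^ 3) * (Dl + Ds) ≤ (10 * m * L ^ 3) * ((219 * m * L ^ 4) * (Sl + Ss)) := by
    calc (2 + 8 * m * L ^ 3) * (Dl + Ds) ≤ (10 * m * L ^ 3) * (Dl + Ds) := mul_le_mul_of_nonneg_right h2 hD0
      _ ≤ (10 * m * L ^ 3) * ((3 + (162 * m + 54) * L ^ 4) * (Sl + Ss)) := mul_le_mul_of_nonneg_left hD (by positivity)
      _ ≤ (10 * m * L ^ 3) * ((219 * m * L ^ 4) * (Sl + Ss)) :=
          mul_le_mul_of_nonneg_left (mul_le_mul_of_nonneg_right h3 hS0) (by positivity)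
  have h5 : (10 * m * L ^ 3) * ((219 * m * L ^ 4) * (Sl + Ss)) = 2190 * m ^ 2 * L ^ 7 * (Sl + Ss) := by ring
  have h6 : 2190 * m ^ 2 * L ^ 7 * (Sl + Ss) ≤ 2400 * m ^ 2 * L ^ 7 * (Sl + Ss) :=
    mul_le_mul_of_nonneg_right (by nlinarith [sq_nonneg m, pow_nonneg hL0 7, mul_nonneg (sq_nonneg m) (pow_nonneg hL0 7)]) hS0
  linarith

/-- ★★ **THE ANGLE LEMMA for the anchor slice.**  `L ≥ 1`, slices indexed by a finite `ι` with the tree-gauged slice `i₀`; reference links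
`r_e` (units, `= 1` on the comb tree) and seam values `g_x` (units, `g 0 = n_C`); link anchor `r_{e₀} = ±n_N` (`n_N ⊥ n_C` pure units).  For chart
coordinates `(a, b)` in the anchor slice — `a i₀ e = 0` on tree links, `b 0 = t·n_C`, `a i₀ e₀ ⊥ n_C` — and EVERY imaginary gauge mode `η`:
`Σ_i Σ_e ‖a i e‖² + Σ_x ‖b x‖² ≤ 2400·|ι|²·L⁷ · (Σ_i Σ_e ‖a i e + (η(∂⁻e) − r_e η(∂⁺e) r_e*)‖² + Σ_x ‖b x + (η x − g_x η x g_x*)‖²)`.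
[cite: Luscher1983, §2] [cite: SeilerLNP1982, §2] -/
theorem anchorSlice_angle {L : ℕ} [NeZero L] {ι : Type*} [Fintype ι] (i₀ : ι) {r : Edge 3 L → ℍ} {g : Site 3 L → ℍ}
    (hr1 : ∀ e, ‖r e‖ = 1) (hg1 : ∀ x, ‖g x‖ = 1) (hrtree : ∀ e, treeEdge e = true → r e = 1)
    {nC nN : ℍ} (hC0 : nC.re = 0) (hC1 : ‖nC‖ = 1) (hN0 : nN.re = 0) (hN1 : ‖nN‖ = 1) (hCN : ⟪nC, nN⟫ = 0) (hg0 : g 0 = nC)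
    {e₀ : Edge 3 L} (he₀ : r e₀ = nN ∨ r e₀ = -nN)
    {a : ι → Edge 3 L → ℍ} {b : Site 3 L → ℍ} (hatree : ∀ e, treeEdge e = true → a i₀ e = 0)
    {t : ℝ} (hb0 : b 0 = t • nC) (ha0 : ⟪a i₀ e₀, nC⟫ = 0) {η : Site 3 L → ℍ} (hη : ∀ x, (η x).re = 0) :
    (∑ i, ∑ e, ‖a i e‖ ^ 2) + ∑ x, ‖b x‖ ^ 2 ≤
      2400 * (Fintype.card ι : ℝ) ^ 2 * (L : ℝ) ^ 7 *
        ((∑ i, ∑ e : Edge 3 L, ‖a i e + (η e.1 - r e * η (e.1.shift e.2) * star (r e))‖ ^ 2) +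
          ∑ x, ‖b x + (η x - g x * η x * star (g x))‖ ^ 2) := by
  -- opaque names for the sums
  obtain ⟨ηb, hηb⟩ : ∃ q : ℍ, q = η 0 := ⟨_, rfl⟩
  obtain ⟨Sl, hSl⟩ : ∃ S : ℝ, S = ∑ i, ∑ e : Edge 3 L, ‖a i e + (η e.1 - r e * η (e.1.shift e.2) * star (r e))‖ ^ 2 := ⟨_, rfl⟩
  obtain ⟨Ss, hSs⟩ : ∃ S : ℝ, S = ∑ x, ‖b x + (η x - g x * η x * star (g x))‖ ^ 2 := ⟨_, rfl⟩
  obtain ⟨P, hP⟩ : ∃ S : ℝ, S = ∑ x : Site 3 L, ‖η x - ηb‖ ^ 2 := ⟨_, rfl⟩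
  obtain ⟨T, hT⟩ : ∃ S : ℝ, S = ∑ e : Edge 3 L, (if treeEdge e = true then ‖η (e.1.shift e.2) - η e.1‖ ^ 2 else 0) := ⟨_, rfl⟩
  obtain ⟨Dl, hDl⟩ : ∃ S : ℝ, S = ∑ i, ∑ e : Edge 3 L, ‖a i e + (ηb - r e * ηb * star (r e))‖ ^ 2 := ⟨_, rfl⟩
  obtain ⟨Ds, hDs⟩ : ∃ S : ℝ, S = ∑ x, ‖b x + (ηb - g x * ηb * star (g x))‖ ^ 2 := ⟨_, rfl⟩
  rw [← hSl, ← hSs]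
  have hSl0 : 0 ≤ Sl := by rw [hSl]; positivity
  have hSs0 : 0 ≤ Ss := by rw [hSs]; positivity
  have hm1 : (1 : ℝ) ≤ (Fintype.card ι : ℝ) := by exact_mod_cast Fintype.card_pos_iff.mpr ⟨i₀⟩
  have hL1 : (1 : ℝ) ≤ L := by exact_mod_cast NeZero.one_le
  -- (i) the tree links of slice `i₀` see `T`
  have hT_le : T ≤ Sl := by
    have h1 : T ≤ ∑ e : Edge 3 L, ‖a i₀ e + (η e.1 - r e * η (e.1.shift e.2) * star (r e))‖ ^ 2 := by
      rw [hT]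
      refine Finset.sum_le_sum fun e _ => ?_
      split_ifs with he
      · rw [hatree e he, hrtree e he, zero_add, one_mul, star_one, mul_one, norm_sub_rev]
      · positivity
    rw [hSl]
    exact h1.trans (Finset.single_le_sum (f := fun i => ∑ e : Edge 3 L, ‖a i e + (η e.1 - r e * η (e.1.shift e.2) * star (r e))‖ ^ 2)
      (fun i _ => by positivity) (Finset.mem_univ i₀))
  -- (ii) Poincaré
  have hPT : P ≤ 9 * (L : ℝ) ^ 4 * T := by rw [hP, hT, hηb]; exact CombTree.comb_poincare η
  -- (iii) the constant-mode terms
  have hDl_le : Dl ≤ 3 * Sl + 18 * (Fintype.card ι : ℝ) * P := by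
    have hpt : ∀ i (e : Edge 3 L), ‖a i e + (ηb - r e * ηb * star (r e))‖ ^ 2 ≤
        3 * (‖a i e + (η e.1 - r e * η (e.1.shift e.2) * star (r e))‖ ^ 2 + ‖η e.1 - ηb‖ ^ 2 + ‖η (e.1.shift e.2) - ηb‖ ^ 2) :=
      fun i e => const_term_sq_le (hr1 e)
    have h3 : ∑ e : Edge 3 L, ‖η e.1 - ηb‖ ^ 2 = 3 * P := by rw [hP]; exact sum_edge_fst (fun x => ‖η x - ηb‖ ^ 2)
    have h4 : ∑ e : Edge 3 L, ‖η (e.1.shift e.2) - ηb‖ ^ 2 = 3 * P := by rw [hP]; exact sum_edge_shift (fun x => ‖η x - ηb‖ ^ 2)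
    calc Dl ≤ ∑ i, ∑ e : Edge 3 L, 3 * (‖a i e + (η e.1 - r e * η (e.1.shift e.2) * star (r e))‖ ^ 2 +
          ‖η e.1 - ηb‖ ^ 2 + ‖η (e.1.shift e.2) - ηb‖ ^ 2) := by
            rw [hDl]; exact Finset.sum_le_sum fun i _ => Finset.sum_le_sum fun e _ => hpt i e
      _ = ∑ i : ι, (3 * (∑ e : Edge 3 L, ‖a i e + (η e.1 - r e * η (e.1.shift e.2) * star (r e))‖ ^ 2) + (9 * P + 9 * P)) := by
            refine Finset.sum_congr rfl fun i _ => ?_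
            rw [show 9 * P + 9 * P = 3 * (3 * P) + 3 * (3 * P) by ring]
            nth_rewrite 1 [← h3]
            rw [← h4, Finset.mul_sum, Finset.mul_sum, Finset.mul_sum, ← Finset.sum_add_distrib, ← Finset.sum_add_distrib]
            exact Finset.sum_congr rfl fun e _ => by ring
      _ = 3 * Sl + 18 * (Fintype.card ι : ℝ) * P := by
            rw [Finset.sum_add_distrib, ← Finset.mul_sum, ← hSl, Finset.sum_const, Finset.card_univ, nsmul_eq_mul]; ring
  have hDs_le : Ds ≤ 3 * Ss + 6 * P := by
    have hpt : ∀ x, ‖b x + (ηb - g x * ηb * star (g x))‖ ^ 2 ≤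
        3 * (‖b x + (η x - g x * η x * star (g x))‖ ^ 2 + ‖η x - ηb‖ ^ 2 + ‖η x - ηb‖ ^ 2) := fun x => const_term_sq_le (hg1 x)
    calc Ds ≤ ∑ x, 3 * (‖b x + (η x - g x * η x * star (g x))‖ ^ 2 + ‖η x - ηb‖ ^ 2 + ‖η x - ηb‖ ^ 2) := by
          rw [hDs]; exact Finset.sum_le_sum fun x _ => hpt x
      _ = 3 * Ss + 6 * P := by
          rw [hSs, hP, Finset.mul_sum, Finset.mul_sum, ← Finset.sum_add_distrib]
          exact Finset.sum_congr rfl fun x _ => by ring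
  -- (iv) the anchors see the constant mode
  have hanch : 4 * ‖ηb‖ ^ 2 ≤ Dl + Ds := by
    have hconjN : r e₀ * ηb * star (r e₀) = nN * ηb * star nN := by
      rcases he₀ with h | h
      · rw [h]
      · rw [h, star_neg, neg_mul, mul_neg, neg_mul, neg_neg]
    have hA := anchor_transversality t hC0 hC1 hN0 hN1 hCN (by rw [hηb]; exact hη 0) ha0 (x := ηb)
    have h1 : ‖a i₀ e₀ + (ηb - nN * ηb * star nN)‖ ^ 2 ≤ Dl := by
      rw [← hconjN, hDl]
      have h2 : ‖a i₀ e₀ + (ηb - r e₀ * ηb * star (r e₀))‖ ^ 2 ≤ ∑ e : Edge 3 L, ‖a i₀ e + (ηb - r e * ηb * star (r e))‖ ^ 2 :=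
        Finset.single_le_sum (f := fun e : Edge 3 L => ‖a i₀ e + (ηb - r e * ηb * star (r e))‖ ^ 2) (fun e _ => by positivity)
          (Finset.mem_univ e₀)
      exact h2.trans (Finset.single_le_sum (f := fun i => ∑ e : Edge 3 L, ‖a i e + (ηb - r e * ηb * star (r e))‖ ^ 2)
        (fun i _ => by positivity) (Finset.mem_univ i₀))
    have h3 : ‖t • nC + (ηb - nC * ηb * star nC)‖ ^ 2 ≤ Ds := by
      rw [← hb0, ← hg0, hDs]
      exact Finset.single_le_sum (f := fun x => ‖b x + (ηb - g x * ηb * star (g x))‖ ^ 2) (fun x _ => by positivity) (Finset.mem_univ 0)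
    linarith
  -- (v) coordinates from the constant-mode terms
  have hcoord : (∑ i, ∑ e, ‖a i e‖ ^ 2) + ∑ x, ‖b x‖ ^ 2 ≤
      2 * (Dl + Ds) + 8 * ‖ηb‖ ^ 2 * ((3 * (Fintype.card ι : ℝ) + 1) * (L : ℝ) ^ 3) := by
    have ha : (∑ i, ∑ e, ‖a i e‖ ^ 2) ≤ 2 * Dl + 8 * ‖ηb‖ ^ 2 * (3 * (Fintype.card ι : ℝ) * (L : ℝ) ^ 3) := by
      calc (∑ i, ∑ e, ‖a i e‖ ^ 2) ≤ ∑ i, ∑ e : Edge 3 L, (2 * ‖a i e + (ηb - r e * ηb * star (r e))‖ ^ 2 + 8 * ‖ηb‖ ^ 2) :=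
            Finset.sum_le_sum fun i _ => Finset.sum_le_sum fun e _ => coord_sq_le (hr1 e)
        _ = ∑ i : ι, (2 * (∑ e : Edge 3 L, ‖a i e + (ηb - r e * ηb * star (r e))‖ ^ 2) + 8 * ‖ηb‖ ^ 2 * (3 * (L : ℝ) ^ 3)) := by
            refine Finset.sum_congr rfl fun i _ => ?_
            rw [Finset.sum_add_distrib, Finset.mul_sum, Finset.sum_const, Finset.card_univ, FemtoTransferGap.card_edge_three, nsmul_eq_mul]
            push_cast; ring
        _ = 2 * Dl + 8 * ‖ηb‖ ^ 2 * (3 * (Fintype.card ι : ℝ) * (L : ℝ) ^ 3) := by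
            rw [Finset.sum_add_distrib, ← Finset.mul_sum, ← hDl, Finset.sum_const, Finset.card_univ, nsmul_eq_mul]; ring
    have hb : ∑ x, ‖b x‖ ^ 2 ≤ 2 * Ds + 8 * ‖ηb‖ ^ 2 * (L : ℝ) ^ 3 := by
      calc ∑ x, ‖b x‖ ^ 2 ≤ ∑ x, (2 * ‖b x + (ηb - g x * ηb * star (g x))‖ ^ 2 + 8 * ‖ηb‖ ^ 2) :=
            Finset.sum_le_sum fun x _ => coord_sq_le (hg1 x)
        _ = 2 * Ds + 8 * ‖ηb‖ ^ 2 * (L : ℝ) ^ 3 := by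
            rw [hDs, Finset.sum_add_distrib, Finset.mul_sum, Finset.sum_const, Finset.card_univ,
              FemtoTransferGap.TwoLattice.Electric.card_site, nsmul_eq_mul]
            push_cast; ring
    linarith
  -- (vi) assembly of the constants
  exact angle_constants hm1 hL1 hSl0 hSs0 (sq_nonneg ‖ηb‖) hT_le hPT hDl_le hDs_le hanch hcoord

end Summit.QuantumFields.YangMills.Theorems.VirialFluxGap.AnchorSlice
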